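import Literature.IUT.HodgeArakelov.GlobalGaussianFrobenioids
import Literature.IUT.HodgeArakelov.GaussianMonoidsGood
import Literature.IUT.HodgeArakelov.BadPrimeGaussianMonoids
import Literature.IUT.HodgeTheaters.GlobalRealifiedFrobenioidsRigidity
import HarnessLib

/-!
# [IUTchII] Cor 4.6 (ii), (iii), (v): uniqueness of `‡C^⊩ ⥲ D^⊩(‡D^⊢)`, equivariance of the diagonal
# isomorphism, naturality of the global evaluation isomorphism — proof companion of
# `GlobalGaussianFrobenioids.lean` (sub-DAG W6-S9-b rows Cor-46.ii.r7, iii.r10, v.r16)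

S. Mochizuki, *Inter-universal Teichmüller theory II*, §4, kurims Dec-2020 manuscript, Corollary 4.6 (ii)
p. 137–138, (iii) p. 138, (v) p. 139 [cite: Mochizuki2012, Cor 4.6 p.137]. Claim key DISPUTED (D-0012).
PROOF-ONLY companion (abc-iut cell, layer L6, seat abc-iut-w5-d100, sub-DAG `SUBDAG-IUTchII-Cor-46.md`); NO
definition, NO `Prop` fact: theorems about objects already REAL in the tree — the divisor monoid
`Φ_{C^⊩_mod}` of the global realified Frobenioid of the REAL initial Θ-data with its comparison maps `ρ_v`
(abc-iut-L5-t2 `InitialThetaData.PhiMod`, `.rho`; abc-iut-w4-d009 rigidity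
`InitialThetaData.phiMod_addEquiv_eq_refl_of_rho_compat`), the diagonal isomorphism `Ψ_0 ⥲ Ψ_⟨F_l^⋇⟩`
(abc-iut-L6-t2 `diagonalIso`, labelwise transport `piIso`), and the global formal evaluation isomorphism
(abc-iut-L6-t2 `globalEvalIso`, `weightedDiagonalHom`).

* **Cor 4.6 (ii)** p. 138 l.3–15: "there is an isomorphism of Frobenioids `‡C^⊩ ⥲ D^⊩(‡D^⊢)` that is uniquely
  determined by the condition that it be compatible with the respective bijections `Prime(−) ⥲ V` and local
  isomorphisms of topological monoids for each `v ∈ V`". At the divisor-monoid model both sides are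
  isomorphs of `Φ_{C^⊩_mod}`; two isomorphisms `f, g : X ⥲ Φ_{C^⊩_mod}` whose "difference" `g ∘ f⁻¹` respects
  `Prime ⥲ V_mod` (acts prime by prime) and the local comparison maps `ρ_v` COINCIDE
  (`addEquiv_eq_of_rho_compat`; also the endomorphism form and the form "two isomorphisms agreeing on the
  distinguished elements `log^⊢_mod(p_v)` coincide", `addEquiv_eq_of_fixes_logMod`).
* **Cor 4.6 (iii)** p. 138 l.41–47 / **Cor 3.5 (iii)** p. 95: the isomorphism `Ψ_cns(†F_≻)_0 ⥲ Ψ_cns(†F_≻)_⟨F_l^⋇⟩`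
  "compatible with the respective labeled `G_v`-actions": the diagonal isomorphism intertwines an
  automorphism `β` of one copy with the diagonal automorphism `(β)_t` of the product of copies
  (`coe_diagonalIso`, `diagonalIso_equivariant`), and the diagonal submonoid is stable under it
  (`piIso_mem_diagonalSubmonoid`).
* **Cor 4.6 (v)** p. 139 l.61–81: the evaluation isomorphisms `C^⊩_env(†HT^Θ) ⥲ … ⥲ C^⊩_gau(†HT^Θ)` obtained "by
  «conjugating» the evaluation isomorphism of Corollary 4.5, (v), by the isomorphism `‡C^⊩ ⥲ D^⊩(‡D^⊢)` of (ii)":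
  the weighted diagonal `φ ↦ (j²·φ)_j` and the global evaluation isomorphism are NATURAL in the divisor monoid —
  they commute with any additive homomorphism/isomorphism `h : Φ → Φ′` applied componentwise
  (`weightedDiagonalHom_natural`, `map_weightedDiagonal_le`, `coe_globalEvalIso`, `globalEvalIso_natural`), so the
  conjugated evaluation isomorphism is again THE global evaluation isomorphism of the target.

Nothing here asserts a disputed claim or takes a side on [IUTchIII] Cor 3.12; typed ≠ proved ≠ endorsed.
-/

namespace Literature.IUT.HodgeArakelov

open scoped NNReal

universe u v w

/-! ### 1. Cor 4.6 (ii): two `Prime`/`ρ`-compatible isomorphisms onto `Φ_{C^⊩_mod}` coincide -/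

section Uniqueness

open Literature.IUT.HodgeTheaters

variable {F : Type u} {K : Type v} {Fbar : Type w} [Field F] [NumberField F] [Field K]
  [NumberField K] [Algebra F K] [Field Fbar] [Algebra F Fbar] [Algebra K Fbar]
  {E : WeierstrassCurve F} [E.IsElliptic] {l : ℕ} {P : BadPlacePredicates K}
  (D : InitialThetaData F K Fbar E l P) {X : Type*} [AddCommMonoid X]

/-- **[IUTchII] Cor 4.6 (ii)** (kurims p. 138 l.3–15, "uniquely determined by the condition that it be
compatible with the respective bijections `Prime(−) ⥲ V` and local isomorphisms"), at the divisor-monoid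
model of the REAL initial Θ-data: two additive isomorphisms `f, g : X ⥲ Φ_{C^⊩_mod}` such that `g ∘ f⁻¹` acts
prime by prime through maps `e_v` that are compatible with the comparison isomorphisms `ρ_w` are EQUAL.
[cite: Mochizuki2012, Cor 4.6 (ii) p.138] -/
theorem addEquiv_eq_of_rho_compat (f g : X ≃+ D.PhiMod)
    (ev : Val (fieldOfModuli E) → (ℝ≥0 →+ ℝ≥0))
    (he : ∀ v x, g (f.symm (Finsupp.single v x)) = Finsupp.single v (ev v x))
    (hρ : ∀ v, ∃ w : Val K, ∀ x, D.rho w (ev v x) = D.rho w x) : f = g := by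
  have h := D.phiMod_addEquiv_eq_refl_of_rho_compat (f.symm.trans g) ev
    (fun v x => by rw [AddEquiv.trans_apply, he]) hρ
  refine AddEquiv.ext fun x => ?_
  have hx := DFunLike.congr_fun h (f x)
  rw [AddEquiv.trans_apply, AddEquiv.symm_apply_apply, AddEquiv.refl_apply] at hx
  exact hx.symm

/-- **[IUTchII] Cor 4.6 (ii)** (kurims p. 138), distinguished-element form: two additive isomorphisms
`f, g : X ⥲ Φ_{C^⊩_mod}` such that `g ∘ f⁻¹` acts prime by prime and fixes every distinguished element
`log^⊢_mod(p_v)` ([IUTchII] Prop 4.2 (ii) / 4.4 (ii): the local isomorphisms match distinguished elements) are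
EQUAL. [cite: Mochizuki2012, Cor 4.6 (ii) p.138] -/
theorem addEquiv_eq_of_fixes_logMod (f g : X ≃+ D.PhiMod)
    (ev : Val (fieldOfModuli E) → (ℝ≥0 →+ ℝ≥0))
    (he : ∀ v x, g (f.symm (Finsupp.single v x)) = Finsupp.single v (ev v x))
    (hfix : ∀ v, g (f.symm (D.logMod v)) = D.logMod v) : f = g := by
  have h := D.phiMod_addEquiv_eq_refl_of_fixes_logMod (f.symm.trans g) ev
    (fun v x => by rw [AddEquiv.trans_apply, he]) (fun v => by rw [AddEquiv.trans_apply, hfix])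
  refine AddEquiv.ext fun x => ?_
  have hx := DFunLike.congr_fun h (f x)
  rw [AddEquiv.trans_apply, AddEquiv.symm_apply_apply, AddEquiv.refl_apply] at hx
  exact hx.symm

/-- **[IUTchII] Cor 4.6 (ii)** (kurims p. 138 l.15–23, "a functorial algorithm for constructing from the
`F^⊩`-prime-strip `‡F^⊩` the isomorphism `‡C^⊩ ⥲ D^⊩(‡D^⊢)`"), endomorphism form at the model: an additive
isomorphism `f : X ⥲ Φ_{C^⊩_mod}` is RIGID — every prime-by-prime, `ρ`-compatible additive self-map `e` of the target
satisfies `e ∘ f = f`. [cite: Mochizuki2012, Cor 4.6 (ii) p.138] -/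
theorem comp_addEquiv_eq_of_rho_compat (f : X ≃+ D.PhiMod) (e : D.PhiMod →+ D.PhiMod)
    (ev : Val (fieldOfModuli E) → (ℝ≥0 →+ ℝ≥0))
    (he : ∀ v x, e (Finsupp.single v x) = Finsupp.single v (ev v x))
    (hρ : ∀ v, ∃ w : Val K, ∀ x, D.rho w (ev v x) = D.rho w x) (x : X) : e (f x) = f x := by
  rw [D.phiMod_addMonoidHom_eq_id_of_rho_compat e ev he hρ, AddMonoidHom.id_apply]

end Uniqueness

/-! ### 2. Cor 4.6 (iii) / Cor 3.5 (iii): the diagonal isomorphism is equivariant -/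

section Diagonal

variable {T : Type u} {M : Type v} [CommMonoid M]

/-- The underlying family of `diagonalIso m` is the constant family `t ↦ m` ("the diagonal submonoid …
may be thought of as the graph of an isomorphism", [IUTchII] Cor 3.5 (iii) p. 95).
[cite: Mochizuki2012, Cor 4.6 (iii) p.138] -/
theorem coe_diagonalIso [Nonempty T] (m : M) (t : T) :
    ((diagonalIso T M m : diagonalSubmonoid T M) : T → M) t = m := rfl

/-- The diagonal submonoid `Ψ_⟨T⟩ ⊆ ∏_T Ψ` is stable under the diagonal automorphism `(β)_t` determined by an
automorphism `β` of one copy (the labeled `G_v`-actions act through the SAME element at every label —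
conjugate synchronization, [IUTchII] Cor 3.5 (i)/(iii), Cor 4.6 (iii)). [cite: Mochizuki2012, Cor 4.6 (iii) p.138] -/
theorem piIso_mem_diagonalSubmonoid (β : M ≃* M) {x : T → M} (hx : x ∈ diagonalSubmonoid T M) :
    piIso T β x ∈ diagonalSubmonoid T M := fun t t' => by
  show β (x t) = β (x t')
  rw [hx t t']

/-- **[IUTchII] Cor 4.6 (iii)** (kurims p. 138 l.41–47: "an isomorphism `Ψ_cns(†F_≻)_0 ⥲ Ψ_cns(†F_≻)_⟨F_l^⋇⟩`") and
**Cor 3.5 (iii)** (p. 95: "compatible with the respective labeled `G_v(M^Θ_*▶)`-actions"): the diagonal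
isomorphism intertwines an automorphism `β` of the zero-labeled copy with the diagonal automorphism `(β)_t`
of the product of labeled copies. [cite: Mochizuki2012, Cor 4.6 (iii) p.138] -/
theorem diagonalIso_equivariant [Nonempty T] (β : M ≃* M) (m : M) :
    ((diagonalIso T M (β m) : diagonalSubmonoid T M) : T → M) =
      piIso T β ((diagonalIso T M m : diagonalSubmonoid T M) : T → M) := by
  funext t
  rfl

/-- The same, as an equality IN the diagonal submonoid: `diagonalIso (β m)` is the image of `diagonalIso m`
under the diagonal automorphism (which preserves the diagonal, `piIso_mem_diagonalSubmonoid`).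
[cite: Mochizuki2012, Cor 4.6 (iii) p.138] -/
theorem diagonalIso_apply_eq [Nonempty T] (β : M ≃* M) (m : M) :
    diagonalIso T M (β m) =
      ⟨piIso T β ((diagonalIso T M m : diagonalSubmonoid T M) : T → M),
        piIso_mem_diagonalSubmonoid β (diagonalIso T M m).2⟩ :=
  Subtype.ext (diagonalIso_equivariant β m)

end Diagonal

/-! ### 3. Cor 4.6 (v): naturality of the weighted diagonal and of the global evaluation isomorphism -/

section Evaluation

variable {Φ : Type u} {Φ' : Type v} [AddCommMonoid Φ] [AddCommMonoid Φ'] (lstar : ℕ)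

/-- The weighted diagonal map `φ ↦ (1²·φ, 2²·φ, …)` commutes with every additive homomorphism applied
componentwise ("in the fashion of the constructions of Propositions 4.2, (iv); 4.4, (iv)", [IUTchII] Cor 4.6 (v)
p. 139). [cite: Mochizuki2012, Cor 4.6 (v) p.139] -/
theorem weightedDiagonalHom_natural (h : Φ →+ Φ') (φ : Φ) (i : Fin lstar) :
    weightedDiagonalHom Φ' lstar (h φ) i = h (weightedDiagonalHom Φ lstar φ i) := by
  simp [weightedDiagonalHom, map_nsmul]

/-- Componentwise application of an additive homomorphism carries the weighted diagonal of `Φ` into the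
weighted diagonal of `Φ′` (the "labeled version" of `‡C^⊩ ⥲ D^⊩(‡D^⊢)` applied to `D^⊩_gau ⊆ ∏_j D^⊩_j`,
[IUTchII] Cor 4.6 (v) p. 139 l.23–34). [cite: Mochizuki2012, Cor 4.6 (v) p.139] -/
theorem map_weightedDiagonal_le (h : Φ →+ Φ') :
    (weightedDiagonal Φ lstar).map (AddMonoidHom.compLeft h (Fin lstar)) ≤ weightedDiagonal Φ' lstar := by
  rintro x ⟨y, hy, rfl⟩
  obtain ⟨φ, rfl⟩ := (AddMonoidHom.mem_mrange).1 hy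
  refine (AddMonoidHom.mem_mrange).2 ⟨h φ, funext fun i => ?_⟩
  rw [weightedDiagonalHom_natural]
  rfl

/-- If `h` is surjective, the weighted diagonal of `Φ′` is exactly the image of that of `Φ`.
[cite: Mochizuki2012, Cor 4.6 (v) p.139] -/
theorem map_weightedDiagonal_eq (h : Φ →+ Φ') (hh : Function.Surjective h) :
    (weightedDiagonal Φ lstar).map (AddMonoidHom.compLeft h (Fin lstar)) = weightedDiagonal Φ' lstar := by
  refine le_antisymm (map_weightedDiagonal_le lstar h) ?_
  intro x hx
  obtain ⟨φ', rfl⟩ := (AddMonoidHom.mem_mrange).1 hx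
  obtain ⟨φ, rfl⟩ := hh φ'
  refine ⟨weightedDiagonalHom Φ lstar φ, (AddMonoidHom.mem_mrange).2 ⟨φ, rfl⟩, funext fun i => ?_⟩
  exact (weightedDiagonalHom_natural lstar h φ i).symm

/-- The underlying family of `globalEvalIso φ` is the weighted diagonal of `φ`.
[cite: Mochizuki2012, Cor 4.5 (v) p.134] -/
theorem coe_globalEvalIso (hl : 0 < lstar) (φ : Φ) :
    ((globalEvalIso Φ lstar hl φ : weightedDiagonal Φ lstar) : Fin lstar → Φ) = weightedDiagonalHom Φ lstar φ :=
  rfl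

/-- **[IUTchII] Cor 4.6 (v)** (kurims p. 139 l.61–81: the evaluation isomorphisms of `C^⊩_env(†HT^Θ)`,
`C^⊩_gau(†HT^Θ)` are obtained "by «conjugating» the evaluation isomorphism of Corollary 4.5, (v), by the
isomorphism `‡C^⊩ ⥲ D^⊩(‡D^⊢)` of (ii)"), at the divisor-monoid level: the global evaluation isomorphism is NATURAL
— for an additive homomorphism `h : Φ → Φ′` (e.g. the divisor map of `‡C^⊩ ⥲ D^⊩(‡D^⊢)`), evaluating after `h`
equals applying `h` componentwise after evaluating; so the conjugated isomorphism IS the global evaluation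
isomorphism of the target. [cite: Mochizuki2012, Cor 4.6 (v) p.139] -/
theorem globalEvalIso_natural (hl : 0 < lstar) (h : Φ →+ Φ') (φ : Φ) :
    ((globalEvalIso Φ' lstar hl (h φ) : weightedDiagonal Φ' lstar) : Fin lstar → Φ') =
      fun i => h (((globalEvalIso Φ lstar hl φ : weightedDiagonal Φ lstar) : Fin lstar → Φ) i) := by
  funext i
  rw [coe_globalEvalIso, coe_globalEvalIso, weightedDiagonalHom_natural]

/-- **[IUTchII] Cor 4.6 (v)** "compatible … with the local evaluation isomorphisms of (iv)": transporting
along an ISOMORPHISM `h : Φ ⥲ Φ′` and then evaluating in `Φ′` is the same as evaluating in `Φ` and transporting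
componentwise; in particular the `Φ′`-evaluation isomorphism is `h`-conjugate to the `Φ`-one.
[cite: Mochizuki2012, Cor 4.6 (v) p.139] -/
theorem globalEvalIso_conj (hl : 0 < lstar) (h : Φ ≃+ Φ') (φ' : Φ') :
    ((globalEvalIso Φ' lstar hl φ' : weightedDiagonal Φ' lstar) : Fin lstar → Φ') =
      fun i => h (((globalEvalIso Φ lstar hl (h.symm φ') : weightedDiagonal Φ lstar) : Fin lstar → Φ) i) := by
  have := globalEvalIso_natural lstar hl h.toAddMonoidHom (h.symm φ')
  simpa only [AddEquiv.coe_toAddMonoidHom, AddEquiv.apply_symm_apply] using this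

end Evaluation

end Literature.IUT.HodgeArakelov
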